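import Literature.Analysis.FluidPDE.TaoCascadeODEProofs
import Literature.Analysis.FluidPDE.TaoCascadeBlowupDynamicsHolds
import HarnessLib

/-!
# Tao's cascade ODE: Theorem 4.2 (ODE blow-up) holds (the discharge of `odeBlowup`)

T. Tao, *Finite time blowup for an averaged three-dimensional Navier–Stokes equation*,
J. Amer. Math. Soc. **29** (2016), 601–674 = arXiv:1402.0290v3, §4 Thm. 4.2 and §6.1 Thm. 6.2.

The named fact `TaoCascade.odeBlowup` (`TaoCascadeODE.lean`) is Thm. 4.2 (ODE blow-up). The source
proves it in one sentence from Thm. 6.2 (§6.1, p. 31 of arXiv v3: "To prove Theorem 4.2, it thus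
suffices to show Theorem 6.2"), the reduction being the choice `m = 4` and the structure constants
of Table 1; that reduction is the accepted `TaoCascade.odeBlowup_of_noGlobalODESolution`
(`TaoCascadeODEProofs.lean`), and Thm. 6.2 itself is the accepted
`TaoCascade.noGlobalODESolution_holds` (`TaoCascadeBlowupDynamicsHolds.lean`, assembled from
Props. 6.3–6.5 and §§6.5–6.7). This file only composes the two; it cannot live in
`TaoCascadeODE.lean` itself (append protocol) because `TaoCascadeBlowupDynamicsHolds` imports that
module. One theorem, no definitions.

## References

* T. Tao, J. Amer. Math. Soc. 29 (2016), 601–674 = arXiv:1402.0290v3, §4 Thm. 4.2; §6.1 Table 1,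
  Thm. 6.2. [`Tao2016AveragedNS`]
-/

noncomputable section

namespace Literature.Analysis.FluidPDE

namespace TaoCascade

/-- **Thm. 4.2 (ODE blow-up) holds**: for `0 < ε₀ < 1` there are `m`, a datum mode and structure
constants obeying the symmetry (4.2) and cancellation (4.3) conditions such that, for `n₀` large
depending on the implied constants, no family `X_{i,n}, E_{i,n}` obeys the conclusions of
Lemma 4.1 — by Thm. 6.2 (`noGlobalODESolution_holds`) and the §6.1 reduction
(`odeBlowup_of_noGlobalODESolution`). [cite: Tao2016AveragedNS, §4 Thm. 4.2; §6.1] -/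
theorem odeBlowup_holds : odeBlowup :=
  odeBlowup_of_noGlobalODESolution noGlobalODESolution_holds

end TaoCascade

end Literature.Analysis.FluidPDE
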